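import Mathlib

/-!
# Exact t₂g identities used by spin–orbit one-band downfolds: Kanamori parameters from Slater
# integrals, and the J_eff = ½ projection of an orbital-diagonal t₂g one-body operator

Two pieces of EXACT algebra that the «material ↦ effective model» pipeline uses when a 5d t₂g⁵
oxide (Sr₂IrO₄, Ba₂IrO₄) is reduced to a one-band J_eff = ½ Hubbard model. Everything here is a
proved theorem; there are no named facts. The physics approximations (spherical screened
interaction; ideal cubic J_eff = ½ doublet, i.e. large spin–orbit coupling and no tetragonal
admixture; neglect of the staggered octahedral-rotation phases) live upstream of these identities
and are named in the docstrings, not hidden in them.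

## 1. Kanamori `U, U′, J` of a t₂g shell from Slater integrals (Georges–de' Medici–Mravlje 2013)

For a spherically symmetric interaction and crystal-field t₂g wave-functions the three Kanamori
couplings are [GeorgesMediciMravlje2012, §2, display after Eq. (up_u) = their Eq. (slater_t2g)]:
`U = F⁰ + 4/49 F² + 4/49 F⁴ = A + 4B + 3C`, `U′ = F⁰ − 2/49 F² − 4/441 F⁴ = A − 2B + C = U − 2J`,
`J = 3/49 F² + 20/441 F⁴ = 3B + C` (Racah `A, B, C`). We define `kanamoriU / kanamoriU' / kanamoriJ`
and `racahA / racahB / racahC` as these rational combinations over `ℝ` and PROVE the printed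
equalities, in particular the rotational-invariance condition `U′ = U − 2J`
(`kanamoriU'_eq_sub_two_mul`). USE: it makes precise which relation a cRPA table (orbital-resolved
`U_mm′, J_mm′`) is being compared against when one writes «U′ ≈ U − 2J» — e.g. Sr₂IrO₄'s cRPA
`U_xy = 2.35, U′ = 1.78, J = 0.16 eV` (Arita et al. 2012) does NOT satisfy it, which is the printed
statement that screened interactions break spherical symmetry, not an inconsistency.

## 2. J_eff = ½ projection of an orbital-diagonal, spin-independent t₂g operator (Wang–Senthil 2011)

With the local-cubic-axis t₂g ⊗ spin basis ordered `(XY↑, XY↓, XZ↑, XZ↓, YZ↑, YZ↓)` the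
J_eff = ½ Kramers doublet is [WangSenthil2010, Eq. (2)] (same states as [KimEtAl2008], phase
convention of Wang–Senthil)
`|+⟩ = (1/√3)( i|XY↑⟩ − |XZ↓⟩ + i|YZ↓⟩ )`, `|−⟩ = (1/√3)( −i|XY↓⟩ + |XZ↑⟩ + i|YZ↑⟩ )`.
We record the UNNORMALISED vectors `jeffUp = √3 |+⟩`, `jeffDown = √3 |−⟩` (entries in `{0, ±1, ±i}`,
so every identity is exact over `ℂ` with no square roots) and an orbital-diagonal,
spin-independent one-body operator `t2gDiag a b c = diag(a, a, b, b, c, c)` (a hopping amplitude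
between two Ir sites that is «orbital diagonal … only in the local cubic axis basis», or an on-site
term) and PROVE: `⟨+|+⟩·3 = 3`, `⟨+|−⟩ = 0` (orthogonality), `⟨±| diag(a,a,b,b,c,c) |±⟩·3 = a + b + c`,
`⟨+| diag |−⟩ = ⟨−| diag |+⟩ = 0`, hence the projected doublet carries the SINGLE spin-independent
amplitude `(a + b + c)/3` (`jeff_projected_amplitude`) — Wang–Senthil's
`t = (1/3)(t₁ + t₄ + t₅)`, `t′ = (1/3)t₂`, `t″ = (1/3)t₃` [WangSenthil2010, Eq. (3) and the line after it]
at rotation angle `θ = 0`.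
§3 adds the staggered rotation `θ_j = ε_j θ`: the phases `e^{i ε_ν θ_j/2}` of
[WangSenthil2010, text before Eq. (3)] give the printed `cos θ` factor and the small «twist»
`(1/3)(t₁ − t₄ − t₅) sin θ` exactly (`twist_jeffUp_angle`). TODO(general form): tetragonal
admixture of the doublet (unequal orbital weights) is not formalised.

§4 proves the trigonometric regrouping behind reading the direct j_eff = ½ fit of
[LenzMartinsBiermann2019, App. A] as `t′ = t₂ − 2ε₁`, `t″ = −ε₁` (`lenz_diag_expand`).

§5 (appended) does for the e_g DOUBLET what §1 does for t₂g: `J_eg = 4B + C = 4/49 F² + 15/441 F⁴`,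
`U′_eg = U − 2J = A − 4B + C`, `U − 3J = A − 8B`, `J_eg − J_t₂g = B`
[GeorgesMediciMravlje2012, Appendix «Two-orbital hamiltonian»] — the relation a two-orbital
(`x²−y²`, `3z²−r²`) nickelate/cuprate box assumes when it writes «U′ = U − 2J».

Every declaration carries its printed source.
-/

noncomputable section

namespace Literature.MathematicalPhysics.QuantumLattice

open Matrix

/-! ### 1. Kanamori parameters from Slater integrals -/

section Kanamori

/-- Intra-orbital Kanamori repulsion of a t₂g shell from Slater integrals:
`U = F⁰ + (4/49) F² + (4/49) F⁴`. [cite: GeorgesMediciMravlje2012, §2 Eq. (slater_t2g)] -/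
def kanamoriU (F0 F2 F4 : ℝ) : ℝ := F0 + 4 / 49 * F2 + 4 / 49 * F4

/-- Inter-orbital (opposite-spin) Kanamori repulsion of a t₂g shell from Slater integrals:
`U′ = F⁰ − (2/49) F² − (4/441) F⁴`. [cite: GeorgesMediciMravlje2012, §2 Eq. (slater_t2g)] -/
def kanamoriU' (F0 F2 F4 : ℝ) : ℝ := F0 - 2 / 49 * F2 - 4 / 441 * F4

/-- Hund's coupling of a t₂g shell from Slater integrals: `J = (3/49) F² + (20/441) F⁴`.
[cite: GeorgesMediciMravlje2012, §2 Eq. (slater_t2g)] -/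
def kanamoriJ (F2 F4 : ℝ) : ℝ := 3 / 49 * F2 + 20 / 441 * F4

/-- Racah parameter `A = F⁰ − (49/441) F⁴`. [cite: GeorgesMediciMravlje2012, §2 Eq. (slater_t2g)] -/
def racahA (F0 F4 : ℝ) : ℝ := F0 - 49 / 441 * F4

/-- Racah parameter `B = (1/49) F² − (5/441) F⁴`. [cite: GeorgesMediciMravlje2012, §2 Eq. (slater_t2g)] -/
def racahB (F2 F4 : ℝ) : ℝ := 1 / 49 * F2 - 5 / 441 * F4

/-- Racah parameter `C = (35/441) F⁴`. [cite: GeorgesMediciMravlje2012, §2 Eq. (slater_t2g)] -/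
def racahC (F4 : ℝ) : ℝ := 35 / 441 * F4

variable (F0 F2 F4 : ℝ)

/-- `U = A + 4B + 3C`. [cite: GeorgesMediciMravlje2012, §2 Eq. (slater_t2g)] -/
theorem kanamoriU_eq_racah :
    kanamoriU F0 F2 F4 = racahA F0 F4 + 4 * racahB F2 F4 + 3 * racahC F4 := by
  unfold kanamoriU racahA racahB racahC; ring

/-- `U′ = A − 2B + C`. [cite: GeorgesMediciMravlje2012, §2 Eq. (slater_t2g)] -/
theorem kanamoriU'_eq_racah :
    kanamoriU' F0 F2 F4 = racahA F0 F4 - 2 * racahB F2 F4 + racahC F4 := by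
  unfold kanamoriU' racahA racahB racahC; ring

/-- `J = 3B + C`. [cite: GeorgesMediciMravlje2012, §2 Eq. (slater_t2g)] -/
theorem kanamoriJ_eq_racah : kanamoriJ F2 F4 = 3 * racahB F2 F4 + racahC F4 := by
  unfold kanamoriJ racahB racahC; ring

/-- The rotational-invariance condition of the t₂g Kanamori Hamiltonian holds identically for
Slater-parametrised (spherically symmetric) interactions: `U′ = U − 2J`.
[cite: GeorgesMediciMravlje2012, §2 Eq. (up_u) and Eq. (slater_t2g)] -/
theorem kanamoriU'_eq_sub_two_mul :
    kanamoriU' F0 F2 F4 = kanamoriU F0 F2 F4 - 2 * kanamoriJ F2 F4 := by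
  unfold kanamoriU' kanamoriU kanamoriJ; ring

/-- Equivalently `U − U′ = 2J`. [cite: GeorgesMediciMravlje2012, §2 Eq. (up_u)] -/
theorem kanamoriU_sub_kanamoriU' :
    kanamoriU F0 F2 F4 - kanamoriU' F0 F2 F4 = 2 * kanamoriJ F2 F4 := by
  rw [kanamoriU'_eq_sub_two_mul]; ring

/-- The prefactor of `N(N−1)/2` in the rotationally invariant form, `U − 3J`, in Slater integrals:
`U − 3J = F⁰ − (5/49) F² − (24/441) F⁴`. [cite: GeorgesMediciMravlje2012, §2 Eq. (ham_t2g_NSL)] -/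
theorem kanamoriU_sub_three_mul :
    kanamoriU F0 F2 F4 - 3 * kanamoriJ F2 F4 = F0 - 5 / 49 * F2 - 24 / 441 * F4 := by
  unfold kanamoriU kanamoriJ; ring

end Kanamori

/-! ### 2. The J_eff = ½ doublet and the projection of an orbital-diagonal t₂g operator -/

section Jeff

/-- `√3 · |J_eff = ½, +⟩` in the basis `(XY↑, XY↓, XZ↑, XZ↓, YZ↑, YZ↓)`:
`( i, 0, 0, −1, 0, i )`. [cite: WangSenthil2010, Eq. (2)] -/
def jeffUp : Fin 6 → ℂ := ![Complex.I, 0, 0, -1, 0, Complex.I]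

/-- `√3 · |J_eff = ½, −⟩` in the basis `(XY↑, XY↓, XZ↑, XZ↓, YZ↑, YZ↓)`:
`( 0, −i, 1, 0, i, 0 )`. [cite: WangSenthil2010, Eq. (2)] -/
def jeffDown : Fin 6 → ℂ := ![0, -Complex.I, 1, 0, Complex.I, 0]

/-- An orbital-diagonal, spin-independent one-body t₂g operator `diag(a, a, b, b, c, c)`
(amplitudes `a = t_XY`, `b = t_XZ`, `c = t_YZ`): the form nearest-neighbour Ir–Ir hopping takes
in the LOCAL cubic-axis basis. [cite: WangSenthil2010, text between Eqs. (2) and (3)] -/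
def t2gDiag (a b c : ℂ) : Matrix (Fin 6) (Fin 6) ℂ := Matrix.diagonal ![a, a, b, b, c, c]

variable (a b c : ℂ)

/-- `‖√3|+⟩‖² = 3`. [cite: WangSenthil2010, Eq. (2)] -/
theorem star_jeffUp_dotProduct_jeffUp : star jeffUp ⬝ᵥ jeffUp = 3 := by
  simp [jeffUp, dotProduct, Fin.sum_univ_succ]
  ring_nf

/-- `‖√3|−⟩‖² = 3`. [cite: WangSenthil2010, Eq. (2)] -/
theorem star_jeffDown_dotProduct_jeffDown : star jeffDown ⬝ᵥ jeffDown = 3 := by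
  simp [jeffDown, dotProduct, Fin.sum_univ_succ]
  ring_nf

/-- Orthogonality `⟨+|−⟩ = 0`. [cite: WangSenthil2010, Eq. (2)] -/
theorem star_jeffUp_dotProduct_jeffDown : star jeffUp ⬝ᵥ jeffDown = 0 := by
  simp [jeffUp, jeffDown, dotProduct, Fin.sum_univ_succ]

/-- Orthogonality `⟨−|+⟩ = 0`. [cite: WangSenthil2010, Eq. (2)] -/
theorem star_jeffDown_dotProduct_jeffUp : star jeffDown ⬝ᵥ jeffUp = 0 := by
  simp [jeffUp, jeffDown, dotProduct, Fin.sum_univ_succ]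

/-- Diagonal matrix element: `⟨√3 +| diag(a,a,b,b,c,c) |√3 +⟩ = a + b + c` — each of the three
orbitals contributes with weight `1/3` of the norm. [cite: WangSenthil2010, Eq. (3)] -/
theorem star_jeffUp_dotProduct_t2gDiag_mulVec_jeffUp :
    star jeffUp ⬝ᵥ (t2gDiag a b c).mulVec jeffUp = a + b + c := by
  simp [jeffUp, t2gDiag, dotProduct, Matrix.mulVec_diagonal, Fin.sum_univ_succ]
  ring_nf
  simp [Complex.I_sq]
  ring

/-- Diagonal matrix element for the other Kramers partner: `⟨√3 −| diag(a,a,b,b,c,c) |√3 −⟩ = a + b + c`.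
[cite: WangSenthil2010, Eq. (3)] -/
theorem star_jeffDown_dotProduct_t2gDiag_mulVec_jeffDown :
    star jeffDown ⬝ᵥ (t2gDiag a b c).mulVec jeffDown = a + b + c := by
  simp [jeffDown, t2gDiag, dotProduct, Matrix.mulVec_diagonal, Fin.sum_univ_succ]
  ring_nf
  simp [Complex.I_sq]
  ring

/-- No pseudospin flip: `⟨+| diag(a,a,b,b,c,c) |−⟩ = 0` (the projected operator is
pseudospin-independent). [cite: WangSenthil2010, Eq. (3)] -/
theorem star_jeffUp_dotProduct_t2gDiag_mulVec_jeffDown :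
    star jeffUp ⬝ᵥ (t2gDiag a b c).mulVec jeffDown = 0 := by
  simp [jeffUp, jeffDown, t2gDiag, dotProduct, Matrix.mulVec_diagonal, Fin.sum_univ_succ]

/-- No pseudospin flip: `⟨−| diag(a,a,b,b,c,c) |+⟩ = 0`. [cite: WangSenthil2010, Eq. (3)] -/
theorem star_jeffDown_dotProduct_t2gDiag_mulVec_jeffUp :
    star jeffDown ⬝ᵥ (t2gDiag a b c).mulVec jeffUp = 0 := by
  simp [jeffUp, jeffDown, t2gDiag, dotProduct, Matrix.mulVec_diagonal, Fin.sum_univ_succ]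

/-- **The projected amplitude.** The Rayleigh quotient of an orbital-diagonal, spin-independent
t₂g operator on the J_eff = ½ doublet is the equal-weight average of the three orbital amplitudes:
`⟨+|T|+⟩/⟨+|+⟩ = (a + b + c)/3` — Wang–Senthil's `t = (1/3)(t₁ + t₄ + t₅)`, `t′ = (1/3)t₂`,
`t″ = (1/3)t₃` at rotation angle `θ = 0`. [cite: WangSenthil2010, Eq. (3) and following line] -/
theorem jeff_projected_amplitude :
    (star jeffUp ⬝ᵥ (t2gDiag a b c).mulVec jeffUp) / (star jeffUp ⬝ᵥ jeffUp) = (a + b + c) / 3 := by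
  rw [star_jeffUp_dotProduct_t2gDiag_mulVec_jeffUp, star_jeffUp_dotProduct_jeffUp]

/-- The same Rayleigh quotient on the Kramers partner (Kramers degeneracy of the projected
amplitude). [cite: WangSenthil2010, Eq. (3)] -/
theorem jeff_projected_amplitude' :
    (star jeffDown ⬝ᵥ (t2gDiag a b c).mulVec jeffDown) / (star jeffDown ⬝ᵥ jeffDown) =
      (a + b + c) / 3 := by
  rw [star_jeffDown_dotProduct_t2gDiag_mulVec_jeffDown, star_jeffDown_dotProduct_jeffDown]

/-- Special case used for an isotropic operator (`a = b = c = t`, e.g. the orbital-independent part):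
the projected amplitude is `t` itself. [cite: WangSenthil2010, Eq. (3)] -/
theorem jeff_projected_amplitude_const (t : ℂ) :
    (star jeffUp ⬝ᵥ (t2gDiag t t t).mulVec jeffUp) / (star jeffUp ⬝ᵥ jeffUp) = t := by
  rw [jeff_projected_amplitude]; ring

end Jeff

/-! ### 3. Staggered octahedral rotation: the `cos θ` factor and the «twist» (general form of §2)

Wang–Senthil rotate the spin quantisation axis to the LOCAL cubic axes of each rotated octahedron
before projecting: `c†_{j,a,ν}` creates `e^{i ε_ν θ_j/2}|j,a,ν⟩` with `θ_j = ε_j θ` staggered on the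
two sublattices [WangSenthil2010, text before Eq. (3)]. We encode the dressing as the diagonal
`spinPhase z = diag(z, z̄, z, z̄, z, z̄)` (spin-↑ components carry `z`, spin-↓ carry `star z`;
`z = e^{iθ/2}` on one sublattice, `star z` on the other) and PROVE the exact inter-sublattice matrix
elements of an orbital-diagonal operator between dressed J_eff states as polynomials in `z, z̄`
(`twist_jeffUp`, `twist_jeffDown`: `a z̄² + (b + c) z²` resp. `a z² + (b + c) z̄²` — the two
Kramers partners twist in OPPOSITE senses, Wang–Senthil's `ε_α`), and the angle form
(`twist_jeffUp_angle`): `(a + b + c) cos θ − i (a − b − c) sin θ`, i.e. after division by the norm 3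
the printed `t = (1/3)(t₁ + t₄ + t₅) cos θ` and twist `|t̄| = (1/3)|t₁ − t₄ − t₅| sin θ`
[WangSenthil2010, Eq. (3) and the two lines after it]; at `θ = 0` (`z = 1`) §2 is recovered
(`twist_jeffUp_one`). The overall sign of the twist term depends on which sublattice carries the bra
(their `ε_j`); we fix bra = `z`, ket = `star z`. -/

section JeffTwist

/-- Spin-dependent phase dressing of the local t₂g ⊗ spin basis on a rotated octahedron:
`diag(z, z̄, z, z̄, z, z̄)` in the basis `(XY↑, XY↓, XZ↑, XZ↓, YZ↑, YZ↓)` (`z = e^{iθ_j/2}`).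
[cite: WangSenthil2010, text before Eq. (3)] -/
def spinPhase (z : ℂ) : Matrix (Fin 6) (Fin 6) ℂ :=
  Matrix.diagonal ![z, star z, z, star z, z, star z]

variable (z a b c : ℂ)

/-- Inter-sublattice matrix element of `diag(a,a,b,b,c,c)` between the dressed `√3|+⟩` states
(bra dressed by `z`, ket by `z̄`): `a z̄² + (b + c) z²`. [cite: WangSenthil2010, Eq. (3)] -/
theorem twist_jeffUp :
    star ((spinPhase z).mulVec jeffUp) ⬝ᵥ
        (t2gDiag a b c).mulVec ((spinPhase (star z)).mulVec jeffUp) =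
      a * (star z) ^ 2 + (b + c) * z ^ 2 := by
  simp [spinPhase, jeffUp, t2gDiag, dotProduct, Matrix.mulVec_diagonal, Fin.sum_univ_succ]
  ring_nf
  simp [Complex.I_sq]
  ring

/-- The Kramers partner twists in the opposite sense: `a z² + (b + c) z̄²` (Wang–Senthil's `ε_α`).
[cite: WangSenthil2010, Eq. (3)] -/
theorem twist_jeffDown :
    star ((spinPhase z).mulVec jeffDown) ⬝ᵥ
        (t2gDiag a b c).mulVec ((spinPhase (star z)).mulVec jeffDown) =
      a * z ^ 2 + (b + c) * (star z) ^ 2 := by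
  simp [spinPhase, jeffDown, t2gDiag, dotProduct, Matrix.mulVec_diagonal, Fin.sum_univ_succ]
  ring_nf
  simp [Complex.I_sq]
  ring

/-- At `z = 1` (no rotation) the dressed matrix element reduces to §2's `a + b + c`.
[cite: WangSenthil2010, Eq. (3)] -/
theorem twist_jeffUp_one :
    star ((spinPhase 1).mulVec jeffUp) ⬝ᵥ
        (t2gDiag a b c).mulVec ((spinPhase (star 1)).mulVec jeffUp) = a + b + c := by
  rw [twist_jeffUp]; simp; ring

/-- `conj e^{iθ/2} = e^{−iθ/2}` for real `θ`. [folklore] -/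
private theorem star_exp_half_mul_I (θ : ℝ) :
    star (Complex.exp ((θ / 2 : ℝ) * Complex.I)) = Complex.exp (-((θ / 2 : ℝ) * Complex.I)) := by
  rw [Complex.star_def, ← Complex.exp_conj]
  congr 1
  simp [Complex.conj_ofReal, map_ofNat]

/-- `(e^{iθ/2})² = e^{iθ}`. [folklore] -/
private theorem exp_half_mul_I_sq (θ : ℝ) :
    Complex.exp ((θ / 2 : ℝ) * Complex.I) ^ 2 = Complex.exp (θ * Complex.I) := by
  rw [← Complex.exp_nat_mul]
  congr 1
  push_cast
  ring

/-- `(e^{−iθ/2})² = e^{−iθ}`. [folklore] -/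
private theorem exp_neg_half_mul_I_sq (θ : ℝ) :
    Complex.exp (-((θ / 2 : ℝ) * Complex.I)) ^ 2 = Complex.exp (-(θ : ℂ) * Complex.I) := by
  rw [← Complex.exp_nat_mul]
  congr 1
  push_cast
  ring

/-- **Angle form (Wang–Senthil's `cos θ` and twist).** With `z = e^{iθ/2}`:
`⟨√3 +, z| diag(a,a,b,b,c,c) |√3 +, z̄⟩ = (a + b + c) cos θ − i (a − b − c) sin θ`; dividing by the
norm `3` gives `t = (1/3)(t₁ + t₄ + t₅) cos θ` and the twist magnitude `(1/3)|t₁ − t₄ − t₅| sin θ`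
for `(a, b, c) = (t₁, t₄, t₅)`. [cite: WangSenthil2010, Eq. (3) and the two lines after it] -/
theorem twist_jeffUp_angle (θ : ℝ) :
    star ((spinPhase (Complex.exp ((θ / 2 : ℝ) * Complex.I))).mulVec jeffUp) ⬝ᵥ
        (t2gDiag a b c).mulVec
          ((spinPhase (star (Complex.exp ((θ / 2 : ℝ) * Complex.I)))).mulVec jeffUp) =
      (a + b + c) * Complex.cos θ - (a - b - c) * Complex.sin θ * Complex.I := by
  rw [twist_jeffUp, star_exp_half_mul_I, exp_half_mul_I_sq, exp_neg_half_mul_I_sq,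
    Complex.exp_mul_I, Complex.exp_mul_I, Complex.cos_neg, Complex.sin_neg]
  ring

/-- The same for the Kramers partner: `(a + b + c) cos θ + i (a − b − c) sin θ` (opposite twist).
[cite: WangSenthil2010, Eq. (3)] -/
theorem twist_jeffDown_angle (θ : ℝ) :
    star ((spinPhase (Complex.exp ((θ / 2 : ℝ) * Complex.I))).mulVec jeffDown) ⬝ᵥ
        (t2gDiag a b c).mulVec
          ((spinPhase (star (Complex.exp ((θ / 2 : ℝ) * Complex.I)))).mulVec jeffDown) =
      (a + b + c) * Complex.cos θ + (a - b - c) * Complex.sin θ * Complex.I := by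
  rw [twist_jeffDown, star_exp_half_mul_I, exp_half_mul_I_sq, exp_neg_half_mul_I_sq,
    Complex.exp_mul_I, Complex.exp_mul_I, Complex.cos_neg, Complex.sin_neg]
  ring

end JeffTwist

/-! ### 4. The hybridisation term of the direct j_eff = ½ tight-binding fit (Lenz–Martins–Biermann 2019)

The direct one-band fit of the DFT j_eff = ½ bands of Sr₂IrO₄ in the reduced (√2 × √2,
two-sublattice) zone has diagonal element `e_k = ε₀ − 2t₂(cos k_x + cos k_y) + ε_hyb(k)` with
`ε_hyb(k) = 4ε₁ γ₁(k)²`, `γ₁(k) = cos((k_x + k_y)/2) + cos((k_x − k_y)/2)`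
[LenzMartinsBiermann2019, App. A Eqs. (A.1)–(A.3) and the text after (A.3)]. In reduced
coordinates `cos k_x + cos k_y` multiplies the next-nearest-neighbour (t′-type) hop of the original
square lattice and `cos(k_x + k_y) + cos(k_x − k_y)` the third-neighbour (t″-type) hop. We PROVE
the elementary expansion `γ₁² = 1 + ½[cos(k_x + k_y) + cos(k_x − k_y)] + cos k_x + cos k_y`
(`lenz_gamma1_sq`) and hence the regrouping of the diagonal element
(`lenz_diag_expand`): `e_k = (ε₀ + 4ε₁) − 2(t₂ − 2ε₁)(cos k_x + cos k_y) + 2ε₁[cos(k_x+k_y) + cos(k_x−k_y)]`,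
i.e. in the `−2t′(…) − 2t″(…)` convention the fit's effective `t′ = t₂ − 2ε₁` and `t″ = −ε₁` — the
identity used to compare that fit (`t₂ = 0.0935`, `ε₁ = 0.021–0.029 eV`) with Wang–Senthil's
`t′ = ⅓t₂`. Pure trigonometry; the physics is in the cited fit. -/

section LenzHybridisation

/-- `(cos u + cos v)² = 1 + ½(cos 2u + cos 2v) + cos(u+v) + cos(u−v)`. [folklore] -/
private theorem cos_add_cos_sq (u v : ℝ) :
    (Real.cos u + Real.cos v) ^ 2 =
      1 + (Real.cos (2 * u) + Real.cos (2 * v)) / 2 + Real.cos (u + v) + Real.cos (u - v) := by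
  rw [Real.cos_two_mul, Real.cos_two_mul, Real.cos_add, Real.cos_sub]
  ring

/-- Expansion of the squared structure factor of the Lenz–Martins–Biermann j_eff fit:
`γ₁(k)² = (cos((k_x+k_y)/2) + cos((k_x−k_y)/2))² = 1 + ½[cos(k_x+k_y) + cos(k_x−k_y)] + cos k_x + cos k_y`
(reduced-zone coordinates). [cite: LenzMartinsBiermann2019, App. A Eq. (A.3)] -/
theorem lenz_gamma1_sq (kx ky : ℝ) :
    (Real.cos ((kx + ky) / 2) + Real.cos ((kx - ky) / 2)) ^ 2 =
      1 + (Real.cos (kx + ky) + Real.cos (kx - ky)) / 2 + Real.cos kx + Real.cos ky := by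
  have h := cos_add_cos_sq ((kx + ky) / 2) ((kx - ky) / 2)
  have h1 : 2 * ((kx + ky) / 2) = kx + ky := by ring
  have h2 : 2 * ((kx - ky) / 2) = kx - ky := by ring
  have h3 : (kx + ky) / 2 + (kx - ky) / 2 = kx := by ring
  have h4 : (kx + ky) / 2 - (kx - ky) / 2 = ky := by ring
  rw [h1, h2, h3, h4] at h
  exact h

/-- Regrouping of the diagonal element of the j_eff fit,
`ε₀ − 2t₂(cos k_x + cos k_y) + 4ε₁γ₁² = (ε₀ + 4ε₁) − 2(t₂ − 2ε₁)(cos k_x + cos k_y) + 2ε₁[cos(k_x+k_y) + cos(k_x−k_y)]`: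
the hybridisation term renormalises the next-nearest-neighbour amplitude to `t′ = t₂ − 2ε₁` and adds a
third-neighbour amplitude `t″ = −ε₁` (in the `−2t′(cos k_x + cos k_y) − 2t″(cos(k_x+k_y) + cos(k_x−k_y))`
convention). [cite: LenzMartinsBiermann2019, App. A Eq. (A.3) and following text] -/
theorem lenz_diag_expand (ε₀ t₂ ε₁ kx ky : ℝ) :
    ε₀ - 2 * t₂ * (Real.cos kx + Real.cos ky) +
        4 * ε₁ * (Real.cos ((kx + ky) / 2) + Real.cos ((kx - ky) / 2)) ^ 2 =
      (ε₀ + 4 * ε₁) - 2 * (t₂ - 2 * ε₁) * (Real.cos kx + Real.cos ky)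
        - 2 * (-ε₁) * (Real.cos (kx + ky) + Real.cos (kx - ky)) := by
  rw [lenz_gamma1_sq]
  ring

end LenzHybridisation

/-! ### 5. The e_g doublet: Kanamori `U, U′, J` from Racah/Slater parameters (Georges–de' Medici–Mravlje 2013, App.)

For the two-orbital e_g pair `(x²−y², 3z²−r²)` — the target of the bilayer-nickelate (La₃Ni₂O₇) and
of the two-band cuprate (`x²−y²` + `3z²−r²`) downfolds — the Kanamori form is exact and «cubic
symmetry itself implies `U′ = U − 2J`»; for a spherically symmetric atom
`U = U′ + 2J = F⁰ + 4/49 F² + 4/49 F⁴ = A + 4B + 3C` and `J = 4B + C`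
[GeorgesMediciMravlje2012, Appendix «Two-orbital hamiltonian», Eq. (slater_eg)]. The intra-orbital
`U` has the SAME Slater expansion as the t₂g one (`kanamoriU`), so we reuse it; we DEFINE the e_g
Hund coupling by the printed Racah form `egJ := 4B + C` and the inter-orbital repulsion by the
printed relation `egU' := U − 2J`, and PROVE the Slater expansions `J_eg = 4/49 F² + 15/441 F⁴`,
`U′_eg = F⁰ − 4/49 F² + 6/441 F⁴ = A − 4B + C`, `U − 3J = A − 8B`, and `J_eg − J_t₂g = B` (the e_g
Hund coupling exceeds the t₂g one by one Racah `B`). REMARK (arithmetic, recorded because a reader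
comparing with the source will meet it): the arXiv text of the cited appendix prints the Slater form
of `J_eg` with an `F²` coefficient `3/49`; expanding the Racah form `4B + C` printed in the same
equation with the paper's own `B = F²/49 − 5F⁴/441`, `C = 35F⁴/441` gives `4/49` (the `F⁴`
coefficient `5/147 = 15/441` agrees) — `egJ_sub_slater349` states the difference `F²/49` exactly; we
formalise the Racah form, which is the one consistent with `U = U′ + 2J` and `U′ = A − 4B + C`. -/

section KanamoriEg

/-- e_g Hund's coupling in Racah parameters, as printed: `J = 4B + C`.
[cite: GeorgesMediciMravlje2012, Appendix (Two-orbital hamiltonian) Eq. (slater_eg)] -/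
def egJ (F2 F4 : ℝ) : ℝ := 4 * racahB F2 F4 + racahC F4

/-- e_g inter-orbital repulsion defined through the printed relation `U = U′ + 2J`
(`U` = `kanamoriU`, the same Slater combination `F⁰ + 4/49 F² + 4/49 F⁴ = A + 4B + 3C` as for t₂g).
[cite: GeorgesMediciMravlje2012, Appendix (Two-orbital hamiltonian) Eq. (slater_eg)] -/
def egU' (F0 F2 F4 : ℝ) : ℝ := kanamoriU F0 F2 F4 - 2 * egJ F2 F4

variable (F0 F2 F4 : ℝ)

/-- Slater expansion of the e_g Hund coupling: `J_eg = 4B + C = 4/49 F² + 15/441 F⁴`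
(`15/441 = 5/147`). [cite: GeorgesMediciMravlje2012, Appendix Eq. (slater_eg)] -/
theorem egJ_slater : egJ F2 F4 = 4 / 49 * F2 + 15 / 441 * F4 := by
  unfold egJ racahB racahC; ring

/-- The arXiv text's Slater form `3/49 F² + 5/147 F⁴` differs from the Racah form `4B + C` it is
equated to by exactly `F²/49` (recorded, not used). [cite: GeorgesMediciMravlje2012, Appendix
Eq. (slater_eg)] -/
theorem egJ_sub_slater349 : egJ F2 F4 - (3 / 49 * F2 + 5 / 147 * F4) = F2 / 49 := by
  unfold egJ racahB racahC; ring

/-- `U − U′ = 2J` for the e_g pair (by the printed defining relation). [cite: GeorgesMediciMravlje2012,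
Appendix: «cubic symmetry itself implies U′ = U − 2J»] -/
theorem kanamoriU_sub_egU' : kanamoriU F0 F2 F4 - egU' F0 F2 F4 = 2 * egJ F2 F4 := by
  unfold egU'; ring

/-- Slater expansion of the e_g inter-orbital repulsion: `U′_eg = F⁰ − 4/49 F² + 6/441 F⁴`.
[cite: GeorgesMediciMravlje2012, Appendix Eq. (slater_eg) (U = U′ + 2J)] -/
theorem egU'_slater : egU' F0 F2 F4 = F0 - 4 / 49 * F2 + 6 / 441 * F4 := by
  unfold egU' egJ kanamoriU racahB racahC; ring

/-- Racah form of the e_g inter-orbital repulsion: `U′_eg = A − 4B + C`.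
[cite: GeorgesMediciMravlje2012, Appendix Eq. (slater_eg) (U = A + 4B + 3C, J = 4B + C)] -/
theorem egU'_eq_racah : egU' F0 F2 F4 = racahA F0 F4 - 4 * racahB F2 F4 + racahC F4 := by
  unfold egU' egJ kanamoriU racahA racahB racahC; ring

/-- Same-spin inter-orbital scale `U′ − J = U − 3J = A − 8B = F⁰ − 8/49 F² − 9/441 F⁴` for the e_g
pair (the prefactor of `N(N−1)/2` is `U − J` in `H_{e_g} = (U−J)N(N−1)/2 + 2J(T_x²+T_z²) − JN`).
[cite: GeorgesMediciMravlje2012, Appendix Eq. (H_eg)] -/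
theorem kanamoriU_sub_three_mul_egJ :
    kanamoriU F0 F2 F4 - 3 * egJ F2 F4 = racahA F0 F4 - 8 * racahB F2 F4 ∧
      kanamoriU F0 F2 F4 - 3 * egJ F2 F4 = F0 - 8 / 49 * F2 - 9 / 441 * F4 := by
  constructor
  · unfold kanamoriU egJ racahA racahB racahC; ring
  · unfold kanamoriU egJ racahB racahC; ring

/-- The e_g Hund coupling exceeds the t₂g one by one Racah `B`: `J_eg − J_t₂g = (4B + C) − (3B + C) = B`.
[cite: GeorgesMediciMravlje2012, §2 Eq. (slater_t2g) and Appendix Eq. (slater_eg)] -/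
theorem egJ_sub_kanamoriJ : egJ F2 F4 - kanamoriJ F2 F4 = racahB F2 F4 := by
  unfold egJ kanamoriJ racahB racahC; ring

end KanamoriEg

end Literature.MathematicalPhysics.QuantumLattice

end
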